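import Summits.ValiantsHypothesis.ValiantsHypothesis.Theorems.LacunarySymmetroidMatrixDescartesPivotRankOneCriticalWindowsFourLoneLetter
import Summits.ValiantsHypothesis.ValiantsHypothesis.Theorems.LacunarySymmetroidMatrixDescartesPivotRankOneCriticalWindowsFourCubicMoment

/-!
# `MatrixDescartes` census — rank-one `(2,4)₁`: THE CUBIC FOLD INEQUALITY `𝒞_W > 0` AND THE UNCONDITIONAL FASTEST-LONE-LETTER LAW (`K = 4`)

HONEST FRAMING.  Object-search cell `pub-symmetroid`, seat `val-sym-mdr-p1` (generation 23); helper file `--supports` the crux item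
stmt-ValiantsHypothesis-18050 (`Theses.LacunarySymmetroid.MatrixDescartes`, OPEN, on HOLD) with NO closure claim.  This file DISCHARGES the hypothesis
`hC` of `…FourLoneLetter.lone_letter_four_right_of_foldCubic_pos`: the cubic fold form `𝒞_W` of `…FourFoldAlgebra` is positive at every fold point
(`foldCubic_pos`), by translating the four-letter data into the abstract moment inequality `…FourCubicMoment.cubicMoment_pos` (masses
`Wₘ(T−tₘ)²`, `U = S_{βg}·β`, `R = (S₂(T+tₘ) − S_{βg}βₘ(T−tₘ))/(T−tₘ)`; the GAP is the fold relation plus `tₘ > 0`, ORDER is `tᵢ, tₖ ≤ t₀`).  Hence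
**`lone_letter_four_right`**: the `K = 4` analogue of `…ThreeLoneLetterCount.lone_letter_three_right` — with ONE letter (of the largest rate) beyond
the pivot letter and two letters below it, pencil-coupled exponents and ANY positive weights, the four-letter window profile has at most two critical
directions beyond the pivot.  A COUNT for one cell of the rank-one `(2,4)₁` row (lone side, lone letter fastest); the row's register `{8, 9}`, the
other splits, `MatrixDescartes` in its window, `DoorA26`/`DoorA34`, credences and `VP ≠ VNP` are untouched.

* §1 `foldCubic_pos` — `(E1) ∧ (E2) ∧ A·S₂ = 2S₁²`, positive weights, `0 < tᵢ, tₖ < t₀ < T < tⱼ`, `bⱼ > bᵢ, bₖ` ⇒ `𝒞_W > 0`.  Ingredients: the bridge identities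
  (`∑dU = S_{βg}·(E2)`, `∑dR = S₂(E1) − S_{βg}(E2)`, `∑dUR = 0`, `∑dU² − ∑dR² = (∑d)S₂² + …`, `∑dU³ − 3∑dUR² = −S_{βg}·4T²·𝒞_W + …`, all
  `linear_combination`), `mixedMoment_neg_of_fastest` (`S_{βg} < 0`), and `cubicMoment_pos`.
* §2 `lone_letter_four_right` — `lone_letter_four_right_of_foldCubic_pos` with `hC := foldCubic_pos`.
[folklore] Polynomial identities and sign bookkeeping.  No definitions, no named facts.
-/

-- `Summit.ValiantsHypothesis.ValiantsHypothesis.…` repeats a component by the D-0017 layout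
-- (single-conjunct summit), which the `dupNamespace` linter flags; the name is mandated.
set_option linter.dupNamespace false

namespace Summit.ValiantsHypothesis.ValiantsHypothesis.Theorems.LacunarySymmetroidMatrixDescartes.Pivot.CriticalWindows.Four

/-! ## 1. Bridge identities (pure algebra) -/

/-- Per-atom rewriting of the rational `R = (P(T+t) − Cβ(T−t))/(T−t)` against the mass `W(T−t)²`. [folklore] -/
theorem atom_rewrite (W b t T P C : ℝ) (ht : T - t ≠ 0) :
    (W * (T - t) ^ 2) * ((P * (T + t) - C * b * (T - t)) / (T - t)) = W * (T - t) * (P * (T + t) - C * b * (T - t)) ∧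
    (W * (T - t) ^ 2) * (C * b) * ((P * (T + t) - C * b * (T - t)) / (T - t)) = W * (T - t) * (C * b) * (P * (T + t) - C * b * (T - t)) ∧
    (W * (T - t) ^ 2) * (C * b) * ((P * (T + t) - C * b * (T - t)) / (T - t)) ^ 2 = W * (C * b) * (P * (T + t) - C * b * (T - t)) ^ 2 ∧
    (W * (T - t) ^ 2) * ((P * (T + t) - C * b * (T - t)) / (T - t)) ^ 2 = W * (P * (T + t) - C * b * (T - t)) ^ 2 ∧
    C * b + (P * (T + t) - C * b * (T - t)) / (T - t) = P * ((T + t) / (T - t)) := by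
  refine ⟨?_, ?_, ?_, ?_, ?_⟩
  · field_simp
  · field_simp
  · field_simp
  · field_simp
  · field_simp
    ring

/-- Bridge identity for `∑ d R`. [folklore] -/
theorem bridge_ER (W₀ Wi Wk Wj a bi bk bj t₀ ti tk tj T : ℝ) :
    W₀ * (T - t₀) * (((-a) ^ 2 * W₀ * (T - t₀) ^ 2 + bi ^ 2 * Wi * (T - ti) ^ 2 + bk ^ 2 * Wk * (T - tk) ^ 2 + bj ^ 2 * Wj * (T - tj) ^ 2) * (T + t₀) - ((-a) * W₀ * (T ^ 2 - t₀ ^ 2) + bi * Wi * (T ^ 2 - ti ^ 2) + bk * Wk * (T ^ 2 - tk ^ 2) + bj * Wj * (T ^ 2 - tj ^ 2)) * (-a) * (T - t₀)) + Wi * (T - ti) * (((-a) ^ 2 * W₀ * (T - t₀) ^ 2 + bi ^ 2 * Wi * (T - ti) ^ 2 + bk ^ 2 * Wk * (T - tk) ^ 2 + bj ^ 2 * Wj * (T - tj) ^ 2) * (T + ti) - ((-a) * W₀ * (T ^ 2 - t₀ ^ 2) + bi * Wi * (T ^ 2 - ti ^ 2) + bk * Wk * (T ^ 2 - tk ^ 2)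 + bj * Wj * (T ^ 2 - tj ^ 2)) * bi * (T - ti)) + Wk * (T - tk) * (((-a) ^ 2 * W₀ * (T - t₀) ^ 2 + bi ^ 2 * Wi * (T - ti) ^ 2 + bk ^ 2 * Wk * (T - tk) ^ 2 + bj ^ 2 * Wj * (T - tj) ^ 2) * (T + tk) - ((-a) * W₀ * (T ^ 2 - t₀ ^ 2) + bi * Wi * (T ^ 2 - ti ^ 2) + bk * Wk * (T ^ 2 - tk ^ 2) + bj * Wj * (T ^ 2 - tj ^ 2)) * bk * (T - tk)) + Wj * (T - tj) * (((-a) ^ 2 * W₀ * (T - t₀) ^ 2 + bi ^ 2 * Wi * (T - ti) ^ 2 + bk ^ 2 * Wk * (T - tk) ^ 2 + bj ^ 2 * Wj * (T - tj) ^ 2) * (T + tj) - ((-a) * W₀ * (T ^ 2 - t₀ ^ 2) + bi * Wi * (T ^ 2 - ti ^ 2) + bk * Wk * (T ^ 2 - tk ^ 2) + bj * Wj * (T ^ 2 - tj ^ 2)) * bj * (T - tj)) = (((-a) ^ 2 * W₀ * (T - t₀) ^ 2 + bi ^ 2 * Wi * (T - ti) ^ 2 + bk ^ 2 * Wk * (T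 - tk) ^ 2 + bj ^ 2 * Wj * (T - tj) ^ 2)) * (W₀ * (T ^ 2 - t₀ ^ 2) + Wi * (T ^ 2 - ti ^ 2) + Wk * (T ^ 2 - tk ^ 2) + Wj * (T ^ 2 - tj ^ 2)) - (((-a) * W₀ * (T ^ 2 - t₀ ^ 2) + bi * Wi * (T ^ 2 - ti ^ 2) + bk * Wk * (T ^ 2 - tk ^ 2) + bj * Wj * (T ^ 2 - tj ^ 2))) * ((-a) * W₀ * (T - t₀) ^ 2 + bi * Wi * (T - ti) ^ 2 + bk * Wk * (T - tk) ^ 2 + bj * Wj * (T - tj) ^ 2) := by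
  ring

/-- Bridge identity for `∑ d U R` (vanishes identically). [folklore] -/
theorem bridge_EUR (W₀ Wi Wk Wj a bi bk bj t₀ ti tk tj T : ℝ) :
    W₀ * (T - t₀) * (((-a) * W₀ * (T ^ 2 - t₀ ^ 2) + bi * Wi * (T ^ 2 - ti ^ 2) + bk * Wk * (T ^ 2 - tk ^ 2) + bj * Wj * (T ^ 2 - tj ^ 2)) * (-a)) * (((-a) ^ 2 * W₀ * (T - t₀) ^ 2 + bi ^ 2 * Wi * (T - ti) ^ 2 + bk ^ 2 * Wk * (T - tk) ^ 2 + bj ^ 2 * Wj * (T - tj) ^ 2) * (T + t₀) - ((-a) * W₀ * (T ^ 2 - t₀ ^ 2) + bi * Wi * (T ^ 2 - ti ^ 2) + bk * Wk * (T ^ 2 - tk ^ 2) + bj * Wj * (T ^ 2 - tj ^ 2)) * (-a) * (T - t₀)) + Wi * (T - ti) * (((-a) * W₀ * (T ^ 2 - t₀ ^ 2) + bi * Wi * (T ^ 2 - ti ^ 2) + bk * Wk * (T ^ 2 - tk ^ 2) + bj * Wj * (T ^ 2 - tj ^ 2)) * bi) * (((-a) ^ 2 * W₀ * (T - t₀)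 ^ 2 + bi ^ 2 * Wi * (T - ti) ^ 2 + bk ^ 2 * Wk * (T - tk) ^ 2 + bj ^ 2 * Wj * (T - tj) ^ 2) * (T + ti) - ((-a) * W₀ * (T ^ 2 - t₀ ^ 2) + bi * Wi * (T ^ 2 - ti ^ 2) + bk * Wk * (T ^ 2 - tk ^ 2) + bj * Wj * (T ^ 2 - tj ^ 2)) * bi * (T - ti)) + Wk * (T - tk) * (((-a) * W₀ * (T ^ 2 - t₀ ^ 2) + bi * Wi * (T ^ 2 - ti ^ 2) + bk * Wk * (T ^ 2 - tk ^ 2) + bj * Wj * (T ^ 2 - tj ^ 2)) * bk) * (((-a) ^ 2 * W₀ * (T - t₀) ^ 2 + bi ^ 2 * Wi * (T - ti) ^ 2 + bk ^ 2 * Wk * (T - tk) ^ 2 + bj ^ 2 * Wj * (T - tj) ^ 2) * (T + tk) - ((-a) * W₀ * (T ^ 2 - t₀ ^ 2) + bi * Wi * (T ^ 2 - ti ^ 2) + bk * Wk * (T ^ 2 - tk ^ 2) + bj * Wj * (T ^ 2 - tj ^ 2)) * bk * (T - tk)) + Wj * (T - tj) * (((-a) * W₀ * (T ^ 2 - t₀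 ^ 2) + bi * Wi * (T ^ 2 - ti ^ 2) + bk * Wk * (T ^ 2 - tk ^ 2) + bj * Wj * (T ^ 2 - tj ^ 2)) * bj) * (((-a) ^ 2 * W₀ * (T - t₀) ^ 2 + bi ^ 2 * Wi * (T - ti) ^ 2 + bk ^ 2 * Wk * (T - tk) ^ 2 + bj ^ 2 * Wj * (T - tj) ^ 2) * (T + tj) - ((-a) * W₀ * (T ^ 2 - t₀ ^ 2) + bi * Wi * (T ^ 2 - ti ^ 2) + bk * Wk * (T ^ 2 - tk ^ 2) + bj * Wj * (T ^ 2 - tj ^ 2)) * bj * (T - tj)) = 0 := by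
  ring

set_option maxHeartbeats 800000 in
-- a large polynomial identity
/-- Bridge identity for `∑ d U² − ∑ d R²` (the GAP comes from the fold relation). [folklore] -/
theorem bridge_QR (W₀ Wi Wk Wj a bi bk bj t₀ ti tk tj T : ℝ) :
    ((W₀ * (T - t₀) ^ 2) * (((-a) * W₀ * (T ^ 2 - t₀ ^ 2) + bi * Wi * (T ^ 2 - ti ^ 2) + bk * Wk * (T ^ 2 - tk ^ 2) + bj * Wj * (T ^ 2 - tj ^ 2)) * (-a)) ^ 2 + (Wi * (T - ti) ^ 2) * (((-a) * W₀ * (T ^ 2 - t₀ ^ 2) + bi * Wi * (T ^ 2 - ti ^ 2) + bk * Wk * (T ^ 2 - tk ^ 2) + bj * Wj * (T ^ 2 - tj ^ 2)) * bi) ^ 2 + (Wk * (T - tk) ^ 2) * (((-a) * W₀ * (T ^ 2 - t₀ ^ 2) + bi * Wi * (T ^ 2 - ti ^ 2) + bk * Wk * (T ^ 2 - tk ^ 2) + bj * Wj * (T ^ 2 - tj ^ 2)) * bk) ^ 2 + (Wj * (T - tj) ^ 2) * (((-a) * W₀ * (T ^ 2 - t₀ ^ 2) + bi * Wi * (T ^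 2 - ti ^ 2) + bk * Wk * (T ^ 2 - tk ^ 2) + bj * Wj * (T ^ 2 - tj ^ 2)) * bj) ^ 2) - (W₀ * (((-a) ^ 2 * W₀ * (T - t₀) ^ 2 + bi ^ 2 * Wi * (T - ti) ^ 2 + bk ^ 2 * Wk * (T - tk) ^ 2 + bj ^ 2 * Wj * (T - tj) ^ 2) * (T + t₀) - ((-a) * W₀ * (T ^ 2 - t₀ ^ 2) + bi * Wi * (T ^ 2 - ti ^ 2) + bk * Wk * (T ^ 2 - tk ^ 2) + bj * Wj * (T ^ 2 - tj ^ 2)) * (-a) * (T - t₀)) ^ 2 + Wi * (((-a) ^ 2 * W₀ * (T - t₀) ^ 2 + bi ^ 2 * Wi * (T - ti) ^ 2 + bk ^ 2 * Wk * (T - tk) ^ 2 + bj ^ 2 * Wj * (T - tj) ^ 2) * (T + ti) - ((-a) * W₀ * (T ^ 2 - t₀ ^ 2) + bi * Wi * (T ^ 2 - ti ^ 2) + bk * Wk * (T ^ 2 - tk ^ 2) + bj * Wj * (T ^ 2 - tj ^ 2)) * bi * (T - ti)) ^ 2 + Wk * (((-a) ^ 2 * W₀ * (T - t₀) ^ 2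 + bi ^ 2 * Wi * (T - ti) ^ 2 + bk ^ 2 * Wk * (T - tk) ^ 2 + bj ^ 2 * Wj * (T - tj) ^ 2) * (T + tk) - ((-a) * W₀ * (T ^ 2 - t₀ ^ 2) + bi * Wi * (T ^ 2 - ti ^ 2) + bk * Wk * (T ^ 2 - tk ^ 2) + bj * Wj * (T ^ 2 - tj ^ 2)) * bk * (T - tk)) ^ 2 + Wj * (((-a) ^ 2 * W₀ * (T - t₀) ^ 2 + bi ^ 2 * Wi * (T - ti) ^ 2 + bk ^ 2 * Wk * (T - tk) ^ 2 + bj ^ 2 * Wj * (T - tj) ^ 2) * (T + tj) - ((-a) * W₀ * (T ^ 2 - t₀ ^ 2) + bi * Wi * (T ^ 2 - ti ^ 2) + bk * Wk * (T ^ 2 - tk ^ 2) + bj * Wj * (T ^ 2 - tj ^ 2)) * bj * (T - tj)) ^ 2) - (W₀ * (T - t₀) ^ 2 + Wi * (T - ti) ^ 2 + Wk * (T - tk) ^ 2 + Wj * (T - tj) ^ 2) * (((-a) ^ 2 * W₀ * (T - t₀) ^ 2 + bi ^ 2 * Wi * (T - ti) ^ 2 + bk ^ 2 * Wk * (T - tk)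 ^ 2 + bj ^ 2 * Wj * (T - tj) ^ 2)) ^ 2
      = -(4 * T ^ 2 * (((-a) ^ 2 * W₀ * (T - t₀) ^ 2 + bi ^ 2 * Wi * (T - ti) ^ 2 + bk ^ 2 * Wk * (T - tk) ^ 2 + bj ^ 2 * Wj * (T - tj) ^ 2))) * ((W₀ + Wi + Wk + Wj) * ((-a) ^ 2 * W₀ * (T - t₀) ^ 2 + bi ^ 2 * Wi * (T - ti) ^ 2 + bk ^ 2 * Wk * (T - tk) ^ 2 + bj ^ 2 * Wj * (T - tj) ^ 2) - 2 * ((-a) * W₀ * (T - t₀) + bi * Wi * (T - ti) + bk * Wk * (T - tk) + bj * Wj * (T - tj)) ^ 2) - (2 * (((-a) ^ 2 * W₀ * (T - t₀) ^ 2 + bi ^ 2 * Wi * (T - ti) ^ 2 + bk ^ 2 * Wk * (T - tk) ^ 2 + bj ^ 2 * Wj * (T - tj) ^ 2)) * ((-a) * W₀ * (T - t₀) ^ 2 + bi * Wi * (T - ti) ^ 2 + bk * Wk * (T - tk) ^ 2 + bj * Wj * (T - tj) ^ 2) + 4 * (((-a) ^ 2 * W₀ * (T - t₀) ^ 2 +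 bi ^ 2 * Wi * (T - ti) ^ 2 + bk ^ 2 * Wk * (T - tk) ^ 2 + bj ^ 2 * Wj * (T - tj) ^ 2)) * (((-a) * W₀ * (T ^ 2 - t₀ ^ 2) + bi * Wi * (T ^ 2 - ti ^ 2) + bk * Wk * (T ^ 2 - tk ^ 2) + bj * Wj * (T ^ 2 - tj ^ 2)))) * ((-a) * W₀ * (T - t₀) ^ 2 + bi * Wi * (T - ti) ^ 2 + bk * Wk * (T - tk) ^ 2 + bj * Wj * (T - tj) ^ 2) + (2 * (((-a) ^ 2 * W₀ * (T - t₀) ^ 2 + bi ^ 2 * Wi * (T - ti) ^ 2 + bk ^ 2 * Wk * (T - tk) ^ 2 + bj ^ 2 * Wj * (T - tj) ^ 2)) ^ 2) * (W₀ * (T ^ 2 - t₀ ^ 2) + Wi * (T ^ 2 - ti ^ 2) + Wk * (T ^ 2 - tk ^ 2) + Wj * (T ^ 2 - tj ^ 2)) := by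
  ring

set_option maxHeartbeats 1600000 in
-- the largest polynomial identity of the file
/-- Bridge identity for the conclusion: `∑dU³ − 3∑dUR² + S_{βg}·4T²·𝒞_W ≡ 0 (mod E2)`. [folklore] -/
theorem bridge_final (W₀ Wi Wk Wj a bi bk bj t₀ ti tk tj T : ℝ) :
    (W₀ * (T - t₀) ^ 2) * (((-a) * W₀ * (T ^ 2 - t₀ ^ 2) + bi * Wi * (T ^ 2 - ti ^ 2) + bk * Wk * (T ^ 2 - tk ^ 2) + bj * Wj * (T ^ 2 - tj ^ 2)) * (-a)) ^ 3 + (Wi * (T - ti) ^ 2) * (((-a) * W₀ * (T ^ 2 - t₀ ^ 2) + bi * Wi * (T ^ 2 - ti ^ 2) + bk * Wk * (T ^ 2 - tk ^ 2) + bj * Wj * (T ^ 2 - tj ^ 2)) * bi) ^ 3 + (Wk * (T - tk) ^ 2) * (((-a) * W₀ * (T ^ 2 - t₀ ^ 2) + bi * Wi * (T ^ 2 - ti ^ 2) + bk * Wk * (T ^ 2 - tk ^ 2) + bj * Wj * (T ^ 2 - tj ^ 2)) * bk) ^ 3 + (Wj * (T - tj) ^ 2) * (((-a) * W₀ * (T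 ^ 2 - t₀ ^ 2) + bi * Wi * (T ^ 2 - ti ^ 2) + bk * Wk * (T ^ 2 - tk ^ 2) + bj * Wj * (T ^ 2 - tj ^ 2)) * bj) ^ 3 - 3 * (W₀ * (((-a) * W₀ * (T ^ 2 - t₀ ^ 2) + bi * Wi * (T ^ 2 - ti ^ 2) + bk * Wk * (T ^ 2 - tk ^ 2) + bj * Wj * (T ^ 2 - tj ^ 2)) * (-a)) * (((-a) ^ 2 * W₀ * (T - t₀) ^ 2 + bi ^ 2 * Wi * (T - ti) ^ 2 + bk ^ 2 * Wk * (T - tk) ^ 2 + bj ^ 2 * Wj * (T - tj) ^ 2) * (T + t₀) - ((-a) * W₀ * (T ^ 2 - t₀ ^ 2) + bi * Wi * (T ^ 2 - ti ^ 2) + bk * Wk * (T ^ 2 - tk ^ 2) + bj * Wj * (T ^ 2 - tj ^ 2)) * (-a) * (T - t₀)) ^ 2 + Wi * (((-a) * W₀ * (T ^ 2 - t₀ ^ 2) + bi * Wi * (T ^ 2 - ti ^ 2) + bk * Wk * (T ^ 2 - tk ^ 2) + bj * Wj * (T ^ 2 - tj ^ 2)) * bi) * (((-a) ^ 2 * W₀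 * (T - t₀) ^ 2 + bi ^ 2 * Wi * (T - ti) ^ 2 + bk ^ 2 * Wk * (T - tk) ^ 2 + bj ^ 2 * Wj * (T - tj) ^ 2) * (T + ti) - ((-a) * W₀ * (T ^ 2 - t₀ ^ 2) + bi * Wi * (T ^ 2 - ti ^ 2) + bk * Wk * (T ^ 2 - tk ^ 2) + bj * Wj * (T ^ 2 - tj ^ 2)) * bi * (T - ti)) ^ 2 + Wk * (((-a) * W₀ * (T ^ 2 - t₀ ^ 2) + bi * Wi * (T ^ 2 - ti ^ 2) + bk * Wk * (T ^ 2 - tk ^ 2) + bj * Wj * (T ^ 2 - tj ^ 2)) * bk) * (((-a) ^ 2 * W₀ * (T - t₀) ^ 2 + bi ^ 2 * Wi * (T - ti) ^ 2 + bk ^ 2 * Wk * (T - tk) ^ 2 + bj ^ 2 * Wj * (T - tj) ^ 2) * (T + tk) - ((-a) * W₀ * (T ^ 2 - t₀ ^ 2) + bi * Wi * (T ^ 2 - ti ^ 2) + bk * Wk * (T ^ 2 - tk ^ 2) + bj * Wj * (T ^ 2 - tj ^ 2)) * bk * (T - tk)) ^ 2 + Wj * (((-a) * W₀ * (T ^ 2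 - t₀ ^ 2) + bi * Wi * (T ^ 2 - ti ^ 2) + bk * Wk * (T ^ 2 - tk ^ 2) + bj * Wj * (T ^ 2 - tj ^ 2)) * bj) * (((-a) ^ 2 * W₀ * (T - t₀) ^ 2 + bi ^ 2 * Wi * (T - ti) ^ 2 + bk ^ 2 * Wk * (T - tk) ^ 2 + bj ^ 2 * Wj * (T - tj) ^ 2) * (T + tj) - ((-a) * W₀ * (T ^ 2 - t₀ ^ 2) + bi * Wi * (T ^ 2 - ti ^ 2) + bk * Wk * (T ^ 2 - tk ^ 2) + bj * Wj * (T ^ 2 - tj ^ 2)) * bj * (T - tj)) ^ 2) = (-(((-a) * W₀ * (T ^ 2 - t₀ ^ 2) + bi * Wi * (T ^ 2 - ti ^ 2) + bk * Wk * (T ^ 2 - tk ^ 2) + bj * Wj * (T ^ 2 - tj ^ 2)))) * (4 * T ^ 2) * (3 * ((-a) * W₀ + bi * Wi + bk * Wk + bj * Wj) * ((-a) ^ 2 * W₀ * (T - t₀) ^ 2 + bi ^ 2 * Wi * (T - ti) ^ 2 + bk ^ 2 * Wk * (T - tk) ^ 2 + bj ^ 2 * Wj * (T - tj) ^ 2)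 ^ 2 - 6 * ((-a) ^ 2 * W₀ * (T - t₀) + bi ^ 2 * Wi * (T - ti) + bk ^ 2 * Wk * (T - tk) + bj ^ 2 * Wj * (T - tj)) * ((-a) * W₀ * (T - t₀) + bi * Wi * (T - ti) + bk * Wk * (T - tk) + bj * Wj * (T - tj)) * ((-a) ^ 2 * W₀ * (T - t₀) ^ 2 + bi ^ 2 * Wi * (T - ti) ^ 2 + bk ^ 2 * Wk * (T - tk) ^ 2 + bj ^ 2 * Wj * (T - tj) ^ 2) + 2 * ((-a) ^ 3 * W₀ * (T - t₀) ^ 2 + bi ^ 3 * Wi * (T - ti) ^ 2 + bk ^ 3 * Wk * (T - tk) ^ 2 + bj ^ 3 * Wj * (T - tj) ^ 2) * ((-a) * W₀ * (T - t₀) + bi * Wi * (T - ti) + bk * Wk * (T - tk) + bj * Wj * (T - tj)) ^ 2)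
      + (((-a) * W₀ * (T ^ 2 - t₀ ^ 2) + bi * Wi * (T ^ 2 - ti ^ 2) + bk * Wk * (T ^ 2 - tk ^ 2) + bj * Wj * (T ^ 2 - tj ^ 2))) * ((-a) * W₀ * (T - t₀) ^ 2 + bi * Wi * (T - ti) ^ 2 + bk * Wk * (T - tk) ^ 2 + bj * Wj * (T - tj) ^ 2) * (-3 * (((-a) ^ 2 * W₀ * (T - t₀) ^ 2 + bi ^ 2 * Wi * (T - ti) ^ 2 + bk ^ 2 * Wk * (T - tk) ^ 2 + bj ^ 2 * Wj * (T - tj) ^ 2)) ^ 2 - 6 * (((-a) ^ 2 * W₀ * (T - t₀) ^ 2 + bi ^ 2 * Wi * (T - ti) ^ 2 + bk ^ 2 * Wk * (T - tk) ^ 2 + bj ^ 2 * Wj * (T - tj) ^ 2)) * ((-a) ^ 2 * W₀ * (T - t₀) * (T + t₀) + bi ^ 2 * Wi * (T - ti) * (T + ti) + bk ^ 2 * Wk * (T - tk) * (T + tk) + bj ^ 2 * Wj * (T - tj) * (T + tj)) + 2 * ((-a) ^ 3 * W₀ * (T - t₀) ^ 2 + bi ^ 3 * Wi * (T - ti) ^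 2 + bk ^ 3 * Wk * (T - tk) ^ 2 + bj ^ 3 * Wj * (T - tj) ^ 2) * ((-a) * W₀ * (T - t₀) ^ 2 + bi * Wi * (T - ti) ^ 2 + bk * Wk * (T - tk) ^ 2 + bj * Wj * (T - tj) ^ 2) + 4 * ((-a) ^ 3 * W₀ * (T - t₀) ^ 2 + bi ^ 3 * Wi * (T - ti) ^ 2 + bk ^ 3 * Wk * (T - tk) ^ 2 + bj ^ 3 * Wj * (T - tj) ^ 2) * (((-a) * W₀ * (T ^ 2 - t₀ ^ 2) + bi * Wi * (T ^ 2 - ti ^ 2) + bk * Wk * (T ^ 2 - tk ^ 2) + bj * Wj * (T ^ 2 - tj ^ 2)))) := by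
  ring

/-! ## 2. The cubic fold form is positive at fold points -/


set_option maxHeartbeats 6000000 in
-- long bookkeeping over large spelled terms (the bridge to the abstract moment inequality)
/-- **`𝒞_W > 0` AT FOLD POINTS.**  For positive weights `W₀, Wᵢ, Wₖ, Wⱼ`, rates `a, bᵢ, bₖ > 0`, `bⱼ > bᵢ, bₖ`, positions `0 < tᵢ, tₖ < t₀ < T < tⱼ`,
the two critical equations and the fold relation `A·S₂ = 2S₁²` imply `3B₀S₂² − 6B₂S₁S₂ + 2B₃S₁² > 0`. [folklore] -/
theorem foldCubic_pos {W₀ Wi Wk Wj a bi bk bj t₀ ti tk tj T : ℝ} (hW₀ : 0 < W₀) (hWi : 0 < Wi) (hWk : 0 < Wk) (hWj : 0 < Wj)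
    (ha : 0 < a) (hbi : 0 < bi) (hbk : 0 < bk) (hbj : 0 < bj) (hij : bi < bj) (hkj : bk < bj)
    (hti : 0 < ti) (htk : 0 < tk) (hi0 : ti < t₀) (hk0 : tk < t₀) (h0T : t₀ < T) (hTj : T < tj)
    (h1 : W₀ * (T ^ 2 - t₀ ^ 2) + Wi * (T ^ 2 - ti ^ 2) + Wk * (T ^ 2 - tk ^ 2) + Wj * (T ^ 2 - tj ^ 2) = 0)
    (h2 : (-a) * W₀ * (T - t₀) ^ 2 + bi * Wi * (T - ti) ^ 2 + bk * Wk * (T - tk) ^ 2 + bj * Wj * (T - tj) ^ 2 = 0)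
    (hfold : (W₀ + Wi + Wk + Wj) * ((-a) ^ 2 * W₀ * (T - t₀) ^ 2 + bi ^ 2 * Wi * (T - ti) ^ 2 + bk ^ 2 * Wk * (T - tk) ^ 2 + bj ^ 2 * Wj * (T - tj) ^ 2) = 2 * ((-a) * W₀ * (T - t₀) + bi * Wi * (T - ti) + bk * Wk * (T - tk) + bj * Wj * (T - tj)) ^ 2) :
    0 < (3 * ((-a) * W₀ + bi * Wi + bk * Wk + bj * Wj) * ((-a) ^ 2 * W₀ * (T - t₀) ^ 2 + bi ^ 2 * Wi * (T - ti) ^ 2 + bk ^ 2 * Wk * (T - tk) ^ 2 + bj ^ 2 * Wj * (T - tj) ^ 2) ^ 2 - 6 * ((-a) ^ 2 * W₀ * (T - t₀) + bi ^ 2 * Wi * (T - ti) + bk ^ 2 * Wk * (T - tk) + bj ^ 2 * Wj * (T - tj)) * ((-a) * W₀ * (T - t₀) + bi * Wi * (T - ti) + bk * Wk * (T - tk) + bj * Wj * (T - tj)) * ((-a) ^ 2 * W₀ * (T - t₀) ^ 2 + bi ^ 2 * Wi * (T - ti) ^ 2 + bk ^ 2 * Wk * (T - tk) ^ 2 + bj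 ^ 2 * Wj * (T - tj) ^ 2) + 2 * ((-a) ^ 3 * W₀ * (T - t₀) ^ 2 + bi ^ 3 * Wi * (T - ti) ^ 2 + bk ^ 3 * Wk * (T - tk) ^ 2 + bj ^ 3 * Wj * (T - tj) ^ 2) * ((-a) * W₀ * (T - t₀) + bi * Wi * (T - ti) + bk * Wk * (T - tk) + bj * Wj * (T - tj)) ^ 2) := by
  have u0 : 0 < T - t₀ := by linarith
  have ui : 0 < T - ti := by linarith
  have uk : 0 < T - tk := by linarith
  have uj : T - tj < 0 := by linarith
  have u0' : T - t₀ ≠ 0 := ne_of_gt u0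
  have ui' : T - ti ≠ 0 := ne_of_gt ui
  have uk' : T - tk ≠ 0 := ne_of_gt uk
  have uj' : T - tj ≠ 0 := ne_of_lt uj
  have hT : 0 < T := by linarith
  have hSbg : ((-a) * W₀ * (T ^ 2 - t₀ ^ 2) + bi * Wi * (T ^ 2 - ti ^ 2) + bk * Wk * (T ^ 2 - tk ^ 2) + bj * Wj * (T ^ 2 - tj ^ 2)) < 0 := mixedMoment_neg_of_fastest hW₀ hWi hWk ha hbj hti htk hi0 hk0 h0T hij hkj h1
  have htj2 : 0 < (T - tj) ^ 2 := by rw [show (T - tj) ^ 2 = (tj - T) ^ 2 by ring]; exact pow_pos (by linarith) 2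
  have hS2 : 0 < ((-a) ^ 2 * W₀ * (T - t₀) ^ 2 + bi ^ 2 * Wi * (T - ti) ^ 2 + bk ^ 2 * Wk * (T - tk) ^ 2 + bj ^ 2 * Wj * (T - tj) ^ 2) := by
    have t0 : 0 ≤ (-a) ^ 2 * W₀ * (T - t₀) ^ 2 := by positivity
    have t1 : 0 ≤ bi ^ 2 * Wi * (T - ti) ^ 2 := by positivity
    have t2 : 0 ≤ bk ^ 2 * Wk * (T - tk) ^ 2 := by positivity
    have t3 : 0 < bj ^ 2 * Wj * (T - tj) ^ 2 := mul_pos (mul_pos (pow_pos hbj 2) hWj) htj2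
    linarith
  have hMp : 0 < W₀ * (T - t₀) ^ 2 + Wi * (T - ti) ^ 2 + Wk * (T - tk) ^ 2 + Wj * (T - tj) ^ 2 := by
    have t0 : 0 < W₀ * (T - t₀) ^ 2 := mul_pos hW₀ (pow_pos u0 2)
    have t1 : 0 ≤ Wi * (T - ti) ^ 2 := by positivity
    have t2 : 0 ≤ Wk * (T - tk) ^ 2 := by positivity
    have t3 : 0 ≤ Wj * (T - tj) ^ 2 := by positivity
    linarith
  -- per-atom rewriting of the rational `R`
  obtain ⟨eR0, eUR0, eUR20, eR20, eg0⟩ := atom_rewrite W₀ (-a) t₀ T (((-a) ^ 2 * W₀ * (T - t₀) ^ 2 + bi ^ 2 * Wi * (T - ti) ^ 2 + bk ^ 2 * Wk * (T - tk) ^ 2 + bj ^ 2 * Wj * (T - tj) ^ 2)) (((-a) * W₀ * (T ^ 2 - t₀ ^ 2) + bi * Wi * (T ^ 2 - ti ^ 2) + bk * Wk * (T ^ 2 - tk ^ 2) + bj * Wj * (T ^ 2 - tj ^ 2))) u0'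
  obtain ⟨eRi, eURi, eUR2i, eR2i, egi⟩ := atom_rewrite Wi bi ti T (((-a) ^ 2 * W₀ * (T - t₀) ^ 2 + bi ^ 2 * Wi * (T - ti) ^ 2 + bk ^ 2 * Wk * (T - tk) ^ 2 + bj ^ 2 * Wj * (T - tj) ^ 2)) (((-a) * W₀ * (T ^ 2 - t₀ ^ 2) + bi * Wi * (T ^ 2 - ti ^ 2) + bk * Wk * (T ^ 2 - tk ^ 2) + bj * Wj * (T ^ 2 - tj ^ 2))) ui'
  obtain ⟨eRk, eURk, eUR2k, eR2k, egk⟩ := atom_rewrite Wk bk tk T (((-a) ^ 2 * W₀ * (T - t₀) ^ 2 + bi ^ 2 * Wi * (T - ti) ^ 2 + bk ^ 2 * Wk * (T - tk) ^ 2 + bj ^ 2 * Wj * (T - tj) ^ 2)) (((-a) * W₀ * (T ^ 2 - t₀ ^ 2) + bi * Wi * (T ^ 2 - ti ^ 2) + bk * Wk * (T ^ 2 - tk ^ 2) + bj * Wj * (T ^ 2 - tj ^ 2))) uk'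
  obtain ⟨eRj, eURj, eUR2j, eR2j, -⟩ := atom_rewrite Wj bj tj T (((-a) ^ 2 * W₀ * (T - t₀) ^ 2 + bi ^ 2 * Wi * (T - ti) ^ 2 + bk ^ 2 * Wk * (T - tk) ^ 2 + bj ^ 2 * Wj * (T - tj) ^ 2)) (((-a) * W₀ * (T ^ 2 - t₀ ^ 2) + bi * Wi * (T ^ 2 - ti ^ 2) + bk * Wk * (T ^ 2 - tk ^ 2) + bj * Wj * (T ^ 2 - tj ^ 2))) uj'
  -- hypotheses of the abstract inequality
  have hEU : (W₀ * (T - t₀) ^ 2) * (((-a) * W₀ * (T ^ 2 - t₀ ^ 2) + bi * Wi * (T ^ 2 - ti ^ 2) + bk * Wk * (T ^ 2 - tk ^ 2) + bj * Wj * (T ^ 2 - tj ^ 2)) * (-a)) + (Wi * (T - ti) ^ 2) * (((-a) * W₀ * (T ^ 2 - t₀ ^ 2) + bi * Wi * (T ^ 2 - ti ^ 2) + bk * Wk * (T ^ 2 - tk ^ 2) + bj * Wj * (T ^ 2 - tj ^ 2)) * bi) + (Wk * (T - tk) ^ 2) * (((-a) * W₀ * (T ^ 2 - t₀ ^ 2)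 + bi * Wi * (T ^ 2 - ti ^ 2) + bk * Wk * (T ^ 2 - tk ^ 2) + bj * Wj * (T ^ 2 - tj ^ 2)) * bk) + (Wj * (T - tj) ^ 2) * (((-a) * W₀ * (T ^ 2 - t₀ ^ 2) + bi * Wi * (T ^ 2 - ti ^ 2) + bk * Wk * (T ^ 2 - tk ^ 2) + bj * Wj * (T ^ 2 - tj ^ 2)) * bj) = 0 := by
    have e : (W₀ * (T - t₀) ^ 2) * (((-a) * W₀ * (T ^ 2 - t₀ ^ 2) + bi * Wi * (T ^ 2 - ti ^ 2) + bk * Wk * (T ^ 2 - tk ^ 2) + bj * Wj * (T ^ 2 - tj ^ 2)) * (-a)) + (Wi * (T - ti) ^ 2) * (((-a) * W₀ * (T ^ 2 - t₀ ^ 2) + bi * Wi * (T ^ 2 - ti ^ 2) + bk * Wk * (T ^ 2 - tk ^ 2) + bj * Wj * (T ^ 2 - tj ^ 2)) * bi) + (Wk * (T - tk) ^ 2) * (((-a) * W₀ * (T ^ 2 - t₀ ^ 2) + bi * Wi * (T ^ 2 - ti ^ 2) + bk * Wk * (T ^ 2 - tk ^ 2) + bj * Wj * (T ^ 2 - tj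 ^ 2)) * bk) + (Wj * (T - tj) ^ 2) * (((-a) * W₀ * (T ^ 2 - t₀ ^ 2) + bi * Wi * (T ^ 2 - ti ^ 2) + bk * Wk * (T ^ 2 - tk ^ 2) + bj * Wj * (T ^ 2 - tj ^ 2)) * bj) = (((-a) * W₀ * (T ^ 2 - t₀ ^ 2) + bi * Wi * (T ^ 2 - ti ^ 2) + bk * Wk * (T ^ 2 - tk ^ 2) + bj * Wj * (T ^ 2 - tj ^ 2))) * ((-a) * W₀ * (T - t₀) ^ 2 + bi * Wi * (T - ti) ^ 2 + bk * Wk * (T - tk) ^ 2 + bj * Wj * (T - tj) ^ 2) := by ring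
    rw [e, h2, mul_zero]
  have hER : (W₀ * (T - t₀) ^ 2) * ((((-a) ^ 2 * W₀ * (T - t₀) ^ 2 + bi ^ 2 * Wi * (T - ti) ^ 2 + bk ^ 2 * Wk * (T - tk) ^ 2 + bj ^ 2 * Wj * (T - tj) ^ 2) * (T + t₀) - ((-a) * W₀ * (T ^ 2 - t₀ ^ 2) + bi * Wi * (T ^ 2 - ti ^ 2) + bk * Wk * (T ^ 2 - tk ^ 2) + bj * Wj * (T ^ 2 - tj ^ 2)) * (-a) * (T - t₀)) / (T - t₀)) + (Wi * (T - ti) ^ 2) * ((((-a) ^ 2 * W₀ * (T - t₀) ^ 2 + bi ^ 2 * Wi * (T - ti) ^ 2 + bk ^ 2 * Wk * (T - tk) ^ 2 + bj ^ 2 * Wj * (T - tj) ^ 2) * (T + ti) - ((-a) * W₀ * (T ^ 2 - t₀ ^ 2) + bi * Wi * (T ^ 2 - ti ^ 2) + bk * Wk * (T ^ 2 - tk ^ 2) + bj * Wj * (T ^ 2 - tj ^ 2)) * bi * (T - ti)) / (T - ti)) + (Wk * (T - tk) ^ 2) * ((((-a) ^ 2 * W₀ * (T - t₀) ^ 2 +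 bi ^ 2 * Wi * (T - ti) ^ 2 + bk ^ 2 * Wk * (T - tk) ^ 2 + bj ^ 2 * Wj * (T - tj) ^ 2) * (T + tk) - ((-a) * W₀ * (T ^ 2 - t₀ ^ 2) + bi * Wi * (T ^ 2 - ti ^ 2) + bk * Wk * (T ^ 2 - tk ^ 2) + bj * Wj * (T ^ 2 - tj ^ 2)) * bk * (T - tk)) / (T - tk)) + (Wj * (T - tj) ^ 2) * ((((-a) ^ 2 * W₀ * (T - t₀) ^ 2 + bi ^ 2 * Wi * (T - ti) ^ 2 + bk ^ 2 * Wk * (T - tk) ^ 2 + bj ^ 2 * Wj * (T - tj) ^ 2) * (T + tj) - ((-a) * W₀ * (T ^ 2 - t₀ ^ 2) + bi * Wi * (T ^ 2 - ti ^ 2) + bk * Wk * (T ^ 2 - tk ^ 2) + bj * Wj * (T ^ 2 - tj ^ 2)) * bj * (T - tj)) / (T - tj)) = 0 := by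
    rw [eR0, eRi, eRk, eRj, bridge_ER, h1, h2, mul_zero, mul_zero, sub_zero]
  have hEUR : (W₀ * (T - t₀) ^ 2) * (((-a) * W₀ * (T ^ 2 - t₀ ^ 2) + bi * Wi * (T ^ 2 - ti ^ 2) + bk * Wk * (T ^ 2 - tk ^ 2) + bj * Wj * (T ^ 2 - tj ^ 2)) * (-a)) * ((((-a) ^ 2 * W₀ * (T - t₀) ^ 2 + bi ^ 2 * Wi * (T - ti) ^ 2 + bk ^ 2 * Wk * (T - tk) ^ 2 + bj ^ 2 * Wj * (T - tj) ^ 2) * (T + t₀) - ((-a) * W₀ * (T ^ 2 - t₀ ^ 2) + bi * Wi * (T ^ 2 - ti ^ 2) + bk * Wk * (T ^ 2 - tk ^ 2) + bj * Wj * (T ^ 2 - tj ^ 2)) * (-a) * (T - t₀)) / (T - t₀)) + (Wi * (T - ti) ^ 2) * (((-a) * W₀ * (T ^ 2 - t₀ ^ 2) + bi * Wi * (T ^ 2 - ti ^ 2) + bk * Wk * (T ^ 2 - tk ^ 2) + bj * Wj * (T ^ 2 - tj ^ 2)) * bi) * ((((-a) ^ 2 * W₀ * (T - t₀) ^ 2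 + bi ^ 2 * Wi * (T - ti) ^ 2 + bk ^ 2 * Wk * (T - tk) ^ 2 + bj ^ 2 * Wj * (T - tj) ^ 2) * (T + ti) - ((-a) * W₀ * (T ^ 2 - t₀ ^ 2) + bi * Wi * (T ^ 2 - ti ^ 2) + bk * Wk * (T ^ 2 - tk ^ 2) + bj * Wj * (T ^ 2 - tj ^ 2)) * bi * (T - ti)) / (T - ti)) + (Wk * (T - tk) ^ 2) * (((-a) * W₀ * (T ^ 2 - t₀ ^ 2) + bi * Wi * (T ^ 2 - ti ^ 2) + bk * Wk * (T ^ 2 - tk ^ 2) + bj * Wj * (T ^ 2 - tj ^ 2)) * bk) * ((((-a) ^ 2 * W₀ * (T - t₀) ^ 2 + bi ^ 2 * Wi * (T - ti) ^ 2 + bk ^ 2 * Wk * (T - tk) ^ 2 + bj ^ 2 * Wj * (T - tj) ^ 2) * (T + tk) - ((-a) * W₀ * (T ^ 2 - t₀ ^ 2) + bi * Wi * (T ^ 2 - ti ^ 2) + bk * Wk * (T ^ 2 - tk ^ 2) + bj * Wj * (T ^ 2 - tj ^ 2)) * bk * (T - tk)) / (T - tk)) + (Wj * (T - tj) ^ 2)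 * (((-a) * W₀ * (T ^ 2 - t₀ ^ 2) + bi * Wi * (T ^ 2 - ti ^ 2) + bk * Wk * (T ^ 2 - tk ^ 2) + bj * Wj * (T ^ 2 - tj ^ 2)) * bj) * ((((-a) ^ 2 * W₀ * (T - t₀) ^ 2 + bi ^ 2 * Wi * (T - ti) ^ 2 + bk ^ 2 * Wk * (T - tk) ^ 2 + bj ^ 2 * Wj * (T - tj) ^ 2) * (T + tj) - ((-a) * W₀ * (T ^ 2 - t₀ ^ 2) + bi * Wi * (T ^ 2 - ti ^ 2) + bk * Wk * (T ^ 2 - tk ^ 2) + bj * Wj * (T ^ 2 - tj ^ 2)) * bj * (T - tj)) / (T - tj)) = 0 := by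
    rw [eUR0, eURi, eURk, eURj]
    exact bridge_EUR W₀ Wi Wk Wj a bi bk bj t₀ ti tk tj T
  -- the three `g`'s
  have hg0pos : 0 < (T + t₀) / (T - t₀) := div_pos (by linarith) u0
  have hgi1 : 1 < (T + ti) / (T - ti) := by rw [lt_div_iff₀ ui]; linarith
  have hgk1 : 1 < (T + tk) / (T - tk) := by rw [lt_div_iff₀ uk]; linarith
  have hgi0 : (T + ti) / (T - ti) ≤ (T + t₀) / (T - t₀) := by
    rw [div_le_div_iff₀ ui u0]
    have e : (T + t₀) * (T - ti) - (T + ti) * (T - t₀) = 2 * T * (t₀ - ti) := by ring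
    have : 0 ≤ 2 * T * (t₀ - ti) := mul_nonneg (by linarith) (by linarith)
    linarith
  have hgk0 : (T + tk) / (T - tk) ≤ (T + t₀) / (T - t₀) := by
    rw [div_le_div_iff₀ uk u0]
    have e : (T + t₀) * (T - tk) - (T + tk) * (T - t₀) = 2 * T * (t₀ - tk) := by ring
    have : 0 ≤ 2 * T * (t₀ - tk) := mul_nonneg (by linarith) (by linarith)
    linarith
  have hgi : 0 ≤ (((-a) * W₀ * (T ^ 2 - t₀ ^ 2) + bi * Wi * (T ^ 2 - ti ^ 2) + bk * Wk * (T ^ 2 - tk ^ 2) + bj * Wj * (T ^ 2 - tj ^ 2)) * bi + ((((-a) ^ 2 * W₀ * (T - t₀) ^ 2 + bi ^ 2 * Wi * (T - ti) ^ 2 + bk ^ 2 * Wk * (T - tk) ^ 2 + bj ^ 2 * Wj * (T - tj) ^ 2) * (T + ti) - ((-a) * W₀ * (T ^ 2 - t₀ ^ 2) + bi * Wi * (T ^ 2 - ti ^ 2) + bk * Wk * (T ^ 2 - tk ^ 2) + bj * Wj * (T ^ 2 - tj ^ 2)) * bi * (T - ti)) / (T - ti))) := by rw [egi]; exact (mul_pos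 hS2 (by linarith)).le
  have hgk : 0 ≤ (((-a) * W₀ * (T ^ 2 - t₀ ^ 2) + bi * Wi * (T ^ 2 - ti ^ 2) + bk * Wk * (T ^ 2 - tk ^ 2) + bj * Wj * (T ^ 2 - tj ^ 2)) * bk + ((((-a) ^ 2 * W₀ * (T - t₀) ^ 2 + bi ^ 2 * Wi * (T - ti) ^ 2 + bk ^ 2 * Wk * (T - tk) ^ 2 + bj ^ 2 * Wj * (T - tj) ^ 2) * (T + tk) - ((-a) * W₀ * (T ^ 2 - t₀ ^ 2) + bi * Wi * (T ^ 2 - ti ^ 2) + bk * Wk * (T ^ 2 - tk ^ 2) + bj * Wj * (T ^ 2 - tj ^ 2)) * bk * (T - tk)) / (T - tk))) := by rw [egk]; exact (mul_pos hS2 (by linarith)).le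
  have hoi : (((-a) * W₀ * (T ^ 2 - t₀ ^ 2) + bi * Wi * (T ^ 2 - ti ^ 2) + bk * Wk * (T ^ 2 - tk ^ 2) + bj * Wj * (T ^ 2 - tj ^ 2)) * bi + ((((-a) ^ 2 * W₀ * (T - t₀) ^ 2 + bi ^ 2 * Wi * (T - ti) ^ 2 + bk ^ 2 * Wk * (T - tk) ^ 2 + bj ^ 2 * Wj * (T - tj) ^ 2) * (T + ti) - ((-a) * W₀ * (T ^ 2 - t₀ ^ 2) + bi * Wi * (T ^ 2 - ti ^ 2) + bk * Wk * (T ^ 2 - tk ^ 2) + bj * Wj * (T ^ 2 - tj ^ 2)) * bi * (T - ti)) / (T - ti))) ≤ (((-a) * W₀ * (T ^ 2 - t₀ ^ 2) + bi * Wi * (T ^ 2 - ti ^ 2) + bk * Wk * (T ^ 2 - tk ^ 2) + bj * Wj * (T ^ 2 - tj ^ 2)) * (-a) + ((((-a) ^ 2 * W₀ * (T - t₀) ^ 2 + bi ^ 2 * Wi * (T - ti) ^ 2 + bk ^ 2 * Wk * (T - tk) ^ 2 + bj ^ 2 * Wj * (T - tj) ^ 2) * (T + t₀) - ((-a) * W₀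 * (T ^ 2 - t₀ ^ 2) + bi * Wi * (T ^ 2 - ti ^ 2) + bk * Wk * (T ^ 2 - tk ^ 2) + bj * Wj * (T ^ 2 - tj ^ 2)) * (-a) * (T - t₀)) / (T - t₀))) := by rw [egi, eg0]; exact mul_le_mul_of_nonneg_left hgi0 hS2.le
  have hok : (((-a) * W₀ * (T ^ 2 - t₀ ^ 2) + bi * Wi * (T ^ 2 - ti ^ 2) + bk * Wk * (T ^ 2 - tk ^ 2) + bj * Wj * (T ^ 2 - tj ^ 2)) * bk + ((((-a) ^ 2 * W₀ * (T - t₀) ^ 2 + bi ^ 2 * Wi * (T - ti) ^ 2 + bk ^ 2 * Wk * (T - tk) ^ 2 + bj ^ 2 * Wj * (T - tj) ^ 2) * (T + tk) - ((-a) * W₀ * (T ^ 2 - t₀ ^ 2) + bi * Wi * (T ^ 2 - ti ^ 2) + bk * Wk * (T ^ 2 - tk ^ 2) + bj * Wj * (T ^ 2 - tj ^ 2)) * bk * (T - tk)) / (T - tk))) ≤ (((-a) * W₀ * (T ^ 2 - t₀ ^ 2) + bi * Wi * (T ^ 2 - ti ^ 2) + bk * Wk * (T ^ 2 - tk ^ 2)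 + bj * Wj * (T ^ 2 - tj ^ 2)) * (-a) + ((((-a) ^ 2 * W₀ * (T - t₀) ^ 2 + bi ^ 2 * Wi * (T - ti) ^ 2 + bk ^ 2 * Wk * (T - tk) ^ 2 + bj ^ 2 * Wj * (T - tj) ^ 2) * (T + t₀) - ((-a) * W₀ * (T ^ 2 - t₀ ^ 2) + bi * Wi * (T ^ 2 - ti ^ 2) + bk * Wk * (T ^ 2 - tk ^ 2) + bj * Wj * (T ^ 2 - tj ^ 2)) * (-a) * (T - t₀)) / (T - t₀))) := by rw [egk, eg0]; exact mul_le_mul_of_nonneg_left hgk0 hS2.le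
  -- the GAP from the fold relation
  have hQR : ((W₀ * (T - t₀) ^ 2) * (((-a) * W₀ * (T ^ 2 - t₀ ^ 2) + bi * Wi * (T ^ 2 - ti ^ 2) + bk * Wk * (T ^ 2 - tk ^ 2) + bj * Wj * (T ^ 2 - tj ^ 2)) * (-a)) ^ 2 + (Wi * (T - ti) ^ 2) * (((-a) * W₀ * (T ^ 2 - t₀ ^ 2) + bi * Wi * (T ^ 2 - ti ^ 2) + bk * Wk * (T ^ 2 - tk ^ 2) + bj * Wj * (T ^ 2 - tj ^ 2)) * bi) ^ 2 + (Wk * (T - tk) ^ 2) * (((-a) * W₀ * (T ^ 2 - t₀ ^ 2) + bi * Wi * (T ^ 2 - ti ^ 2) + bk * Wk * (T ^ 2 - tk ^ 2) + bj * Wj * (T ^ 2 - tj ^ 2)) * bk) ^ 2 + (Wj * (T - tj) ^ 2) * (((-a) * W₀ * (T ^ 2 - t₀ ^ 2) + bi * Wi * (T ^ 2 - ti ^ 2) + bk * Wk * (T ^ 2 - tk ^ 2) + bj * Wj * (T ^ 2 - tj ^ 2)) * bj) ^ 2) - ((W₀ * (T - t₀) ^ 2) * ((((-a) ^ 2 *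 W₀ * (T - t₀) ^ 2 + bi ^ 2 * Wi * (T - ti) ^ 2 + bk ^ 2 * Wk * (T - tk) ^ 2 + bj ^ 2 * Wj * (T - tj) ^ 2) * (T + t₀) - ((-a) * W₀ * (T ^ 2 - t₀ ^ 2) + bi * Wi * (T ^ 2 - ti ^ 2) + bk * Wk * (T ^ 2 - tk ^ 2) + bj * Wj * (T ^ 2 - tj ^ 2)) * (-a) * (T - t₀)) / (T - t₀)) ^ 2 + (Wi * (T - ti) ^ 2) * ((((-a) ^ 2 * W₀ * (T - t₀) ^ 2 + bi ^ 2 * Wi * (T - ti) ^ 2 + bk ^ 2 * Wk * (T - tk) ^ 2 + bj ^ 2 * Wj * (T - tj) ^ 2) * (T + ti) - ((-a) * W₀ * (T ^ 2 - t₀ ^ 2) + bi * Wi * (T ^ 2 - ti ^ 2) + bk * Wk * (T ^ 2 - tk ^ 2) + bj * Wj * (T ^ 2 - tj ^ 2)) * bi * (T - ti)) / (T - ti)) ^ 2 + (Wk * (T - tk) ^ 2) * ((((-a) ^ 2 * W₀ * (T - t₀) ^ 2 + bi ^ 2 * Wi * (T - ti) ^ 2 + bk ^ 2 * Wk * (T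 - tk) ^ 2 + bj ^ 2 * Wj * (T - tj) ^ 2) * (T + tk) - ((-a) * W₀ * (T ^ 2 - t₀ ^ 2) + bi * Wi * (T ^ 2 - ti ^ 2) + bk * Wk * (T ^ 2 - tk ^ 2) + bj * Wj * (T ^ 2 - tj ^ 2)) * bk * (T - tk)) / (T - tk)) ^ 2 + (Wj * (T - tj) ^ 2) * ((((-a) ^ 2 * W₀ * (T - t₀) ^ 2 + bi ^ 2 * Wi * (T - ti) ^ 2 + bk ^ 2 * Wk * (T - tk) ^ 2 + bj ^ 2 * Wj * (T - tj) ^ 2) * (T + tj) - ((-a) * W₀ * (T ^ 2 - t₀ ^ 2) + bi * Wi * (T ^ 2 - ti ^ 2) + bk * Wk * (T ^ 2 - tk ^ 2) + bj * Wj * (T ^ 2 - tj ^ 2)) * bj * (T - tj)) / (T - tj)) ^ 2) = (W₀ * (T - t₀) ^ 2 + Wi * (T - ti) ^ 2 + Wk * (T - tk) ^ 2 + Wj * (T - tj) ^ 2) * (((-a) ^ 2 * W₀ * (T - t₀) ^ 2 + bi ^ 2 * Wi * (T - ti) ^ 2 + bk ^ 2 * Wk * (T - tk) ^ 2 + bj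 ^ 2 * Wj * (T - tj) ^ 2)) ^ 2 := by
    rw [eR20, eR2i, eR2k, eR2j]
    have hb := bridge_QR W₀ Wi Wk Wj a bi bk bj t₀ ti tk tj T
    have hf0 : (W₀ + Wi + Wk + Wj) * ((-a) ^ 2 * W₀ * (T - t₀) ^ 2 + bi ^ 2 * Wi * (T - ti) ^ 2 + bk ^ 2 * Wk * (T - tk) ^ 2 + bj ^ 2 * Wj * (T - tj) ^ 2) - 2 * ((-a) * W₀ * (T - t₀) + bi * Wi * (T - ti) + bk * Wk * (T - tk) + bj * Wj * (T - tj)) ^ 2 = 0 := by rw [hfold]; ring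
    rw [hf0, h1, h2] at hb
    simp only [mul_zero, add_zero, sub_zero, zero_add] at hb
    exact sub_eq_zero.mp hb
  have hM' : ((W₀ * (T - t₀) ^ 2) + (Wi * (T - ti) ^ 2) + (Wk * (T - tk) ^ 2) + (Wj * (T - tj) ^ 2)) = W₀ * (T - t₀) ^ 2 + Wi * (T - ti) ^ 2 + Wk * (T - tk) ^ 2 + Wj * (T - tj) ^ 2 := by ring
  have hgapi : ((W₀ * (T - t₀) ^ 2) * (((-a) * W₀ * (T ^ 2 - t₀ ^ 2) + bi * Wi * (T ^ 2 - ti ^ 2) + bk * Wk * (T ^ 2 - tk ^ 2) + bj * Wj * (T ^ 2 - tj ^ 2)) * (-a)) ^ 2 + (Wi * (T - ti) ^ 2) * (((-a) * W₀ * (T ^ 2 - t₀ ^ 2) + bi * Wi * (T ^ 2 - ti ^ 2) + bk * Wk * (T ^ 2 - tk ^ 2) + bj * Wj * (T ^ 2 - tj ^ 2)) * bi) ^ 2 + (Wk * (T - tk) ^ 2) * (((-a) * W₀ * (T ^ 2 - t₀ ^ 2) + bi * Wi * (T ^ 2 - ti ^ 2) + bk * Wk * (T ^ 2 - tk ^ 2)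 + bj * Wj * (T ^ 2 - tj ^ 2)) * bk) ^ 2 + (Wj * (T - tj) ^ 2) * (((-a) * W₀ * (T ^ 2 - t₀ ^ 2) + bi * Wi * (T ^ 2 - ti ^ 2) + bk * Wk * (T ^ 2 - tk ^ 2) + bj * Wj * (T ^ 2 - tj ^ 2)) * bj) ^ 2) - ((W₀ * (T - t₀) ^ 2) * ((((-a) ^ 2 * W₀ * (T - t₀) ^ 2 + bi ^ 2 * Wi * (T - ti) ^ 2 + bk ^ 2 * Wk * (T - tk) ^ 2 + bj ^ 2 * Wj * (T - tj) ^ 2) * (T + t₀) - ((-a) * W₀ * (T ^ 2 - t₀ ^ 2) + bi * Wi * (T ^ 2 - ti ^ 2) + bk * Wk * (T ^ 2 - tk ^ 2) + bj * Wj * (T ^ 2 - tj ^ 2)) * (-a) * (T - t₀)) / (T - t₀)) ^ 2 + (Wi * (T - ti) ^ 2) * ((((-a) ^ 2 * W₀ * (T - t₀) ^ 2 + bi ^ 2 * Wi * (T - ti) ^ 2 + bk ^ 2 * Wk * (T - tk) ^ 2 + bj ^ 2 * Wj * (T - tj) ^ 2) * (T + ti) - ((-a) * W₀ * (T ^ 2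 - t₀ ^ 2) + bi * Wi * (T ^ 2 - ti ^ 2) + bk * Wk * (T ^ 2 - tk ^ 2) + bj * Wj * (T ^ 2 - tj ^ 2)) * bi * (T - ti)) / (T - ti)) ^ 2 + (Wk * (T - tk) ^ 2) * ((((-a) ^ 2 * W₀ * (T - t₀) ^ 2 + bi ^ 2 * Wi * (T - ti) ^ 2 + bk ^ 2 * Wk * (T - tk) ^ 2 + bj ^ 2 * Wj * (T - tj) ^ 2) * (T + tk) - ((-a) * W₀ * (T ^ 2 - t₀ ^ 2) + bi * Wi * (T ^ 2 - ti ^ 2) + bk * Wk * (T ^ 2 - tk ^ 2) + bj * Wj * (T ^ 2 - tj ^ 2)) * bk * (T - tk)) / (T - tk)) ^ 2 + (Wj * (T - tj) ^ 2) * ((((-a) ^ 2 * W₀ * (T - t₀) ^ 2 + bi ^ 2 * Wi * (T - ti) ^ 2 + bk ^ 2 * Wk * (T - tk) ^ 2 + bj ^ 2 * Wj * (T - tj) ^ 2) * (T + tj) - ((-a) * W₀ * (T ^ 2 - t₀ ^ 2) + bi * Wi * (T ^ 2 - ti ^ 2) + bk * Wk * (T ^ 2 - tk ^ 2) + bj *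 Wj * (T ^ 2 - tj ^ 2)) * bj * (T - tj)) / (T - tj)) ^ 2) < ((W₀ * (T - t₀) ^ 2) + (Wi * (T - ti) ^ 2) + (Wk * (T - tk) ^ 2) + (Wj * (T - tj) ^ 2)) * (((-a) * W₀ * (T ^ 2 - t₀ ^ 2) + bi * Wi * (T ^ 2 - ti ^ 2) + bk * Wk * (T ^ 2 - tk ^ 2) + bj * Wj * (T ^ 2 - tj ^ 2)) * bi + ((((-a) ^ 2 * W₀ * (T - t₀) ^ 2 + bi ^ 2 * Wi * (T - ti) ^ 2 + bk ^ 2 * Wk * (T - tk) ^ 2 + bj ^ 2 * Wj * (T - tj) ^ 2) * (T + ti) - ((-a) * W₀ * (T ^ 2 - t₀ ^ 2) + bi * Wi * (T ^ 2 - ti ^ 2) + bk * Wk * (T ^ 2 - tk ^ 2) + bj * Wj * (T ^ 2 - tj ^ 2)) * bi * (T - ti)) / (T - ti))) ^ 2 := by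
    rw [hQR, hM', egi]
    have hg2 : 1 < ((T + ti) / (T - ti)) ^ 2 := one_lt_pow₀ hgi1 two_ne_zero
    have hposM : 0 < (W₀ * (T - t₀) ^ 2 + Wi * (T - ti) ^ 2 + Wk * (T - tk) ^ 2 + Wj * (T - tj) ^ 2) * (((-a) ^ 2 * W₀ * (T - t₀) ^ 2 + bi ^ 2 * Wi * (T - ti) ^ 2 + bk ^ 2 * Wk * (T - tk) ^ 2 + bj ^ 2 * Wj * (T - tj) ^ 2)) ^ 2 := mul_pos hMp (pow_pos hS2 2)
    have hlt := mul_lt_mul_of_pos_left hg2 hposM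
    calc (W₀ * (T - t₀) ^ 2 + Wi * (T - ti) ^ 2 + Wk * (T - tk) ^ 2 + Wj * (T - tj) ^ 2) * (((-a) ^ 2 * W₀ * (T - t₀) ^ 2 + bi ^ 2 * Wi * (T - ti) ^ 2 + bk ^ 2 * Wk * (T - tk) ^ 2 + bj ^ 2 * Wj * (T - tj) ^ 2)) ^ 2 = (W₀ * (T - t₀) ^ 2 + Wi * (T - ti) ^ 2 + Wk * (T - tk) ^ 2 + Wj * (T - tj) ^ 2) * (((-a) ^ 2 * W₀ * (T - t₀) ^ 2 + bi ^ 2 * Wi * (T - ti) ^ 2 + bk ^ 2 * Wk * (T - tk) ^ 2 + bj ^ 2 * Wj * (T - tj) ^ 2)) ^ 2 * 1 := (mul_one _).symm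
      _ < (W₀ * (T - t₀) ^ 2 + Wi * (T - ti) ^ 2 + Wk * (T - tk) ^ 2 + Wj * (T - tj) ^ 2) * (((-a) ^ 2 * W₀ * (T - t₀) ^ 2 + bi ^ 2 * Wi * (T - ti) ^ 2 + bk ^ 2 * Wk * (T - tk) ^ 2 + bj ^ 2 * Wj * (T - tj) ^ 2)) ^ 2 * ((T + ti) / (T - ti)) ^ 2 := hlt
      _ = (W₀ * (T - t₀) ^ 2 + Wi * (T - ti) ^ 2 + Wk * (T - tk) ^ 2 + Wj * (T - tj) ^ 2) * ((((-a) ^ 2 * W₀ * (T - t₀) ^ 2 + bi ^ 2 * Wi * (T - ti) ^ 2 + bk ^ 2 * Wk * (T - tk) ^ 2 + bj ^ 2 * Wj * (T - tj) ^ 2)) * ((T + ti) / (T - ti))) ^ 2 := by rw [mul_pow, mul_assoc]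
  have hgapk : ((W₀ * (T - t₀) ^ 2) * (((-a) * W₀ * (T ^ 2 - t₀ ^ 2) + bi * Wi * (T ^ 2 - ti ^ 2) + bk * Wk * (T ^ 2 - tk ^ 2) + bj * Wj * (T ^ 2 - tj ^ 2)) * (-a)) ^ 2 + (Wi * (T - ti) ^ 2) * (((-a) * W₀ * (T ^ 2 - t₀ ^ 2) + bi * Wi * (T ^ 2 - ti ^ 2) + bk * Wk * (T ^ 2 - tk ^ 2) + bj * Wj * (T ^ 2 - tj ^ 2)) * bi) ^ 2 + (Wk * (T - tk) ^ 2) * (((-a) * W₀ * (T ^ 2 - t₀ ^ 2) + bi * Wi * (T ^ 2 - ti ^ 2) + bk * Wk * (T ^ 2 - tk ^ 2) + bj * Wj * (T ^ 2 - tj ^ 2)) * bk) ^ 2 + (Wj * (T - tj) ^ 2) * (((-a) * W₀ * (T ^ 2 - t₀ ^ 2) + bi * Wi * (T ^ 2 - ti ^ 2) + bk * Wk * (T ^ 2 - tk ^ 2) + bj * Wj * (T ^ 2 - tj ^ 2)) * bj) ^ 2) - ((W₀ * (T - t₀) ^ 2) * ((((-a) ^ 2 * W₀ * (T - t₀) ^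 2 + bi ^ 2 * Wi * (T - ti) ^ 2 + bk ^ 2 * Wk * (T - tk) ^ 2 + bj ^ 2 * Wj * (T - tj) ^ 2) * (T + t₀) - ((-a) * W₀ * (T ^ 2 - t₀ ^ 2) + bi * Wi * (T ^ 2 - ti ^ 2) + bk * Wk * (T ^ 2 - tk ^ 2) + bj * Wj * (T ^ 2 - tj ^ 2)) * (-a) * (T - t₀)) / (T - t₀)) ^ 2 + (Wi * (T - ti) ^ 2) * ((((-a) ^ 2 * W₀ * (T - t₀) ^ 2 + bi ^ 2 * Wi * (T - ti) ^ 2 + bk ^ 2 * Wk * (T - tk) ^ 2 + bj ^ 2 * Wj * (T - tj) ^ 2) * (T + ti) - ((-a) * W₀ * (T ^ 2 - t₀ ^ 2) + bi * Wi * (T ^ 2 - ti ^ 2) + bk * Wk * (T ^ 2 - tk ^ 2) + bj * Wj * (T ^ 2 - tj ^ 2)) * bi * (T - ti)) / (T - ti)) ^ 2 + (Wk * (T - tk) ^ 2) * ((((-a) ^ 2 * W₀ * (T - t₀) ^ 2 + bi ^ 2 * Wi * (T - ti) ^ 2 + bk ^ 2 * Wk * (T - tk) ^ 2 + bj ^ 2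 * Wj * (T - tj) ^ 2) * (T + tk) - ((-a) * W₀ * (T ^ 2 - t₀ ^ 2) + bi * Wi * (T ^ 2 - ti ^ 2) + bk * Wk * (T ^ 2 - tk ^ 2) + bj * Wj * (T ^ 2 - tj ^ 2)) * bk * (T - tk)) / (T - tk)) ^ 2 + (Wj * (T - tj) ^ 2) * ((((-a) ^ 2 * W₀ * (T - t₀) ^ 2 + bi ^ 2 * Wi * (T - ti) ^ 2 + bk ^ 2 * Wk * (T - tk) ^ 2 + bj ^ 2 * Wj * (T - tj) ^ 2) * (T + tj) - ((-a) * W₀ * (T ^ 2 - t₀ ^ 2) + bi * Wi * (T ^ 2 - ti ^ 2) + bk * Wk * (T ^ 2 - tk ^ 2) + bj * Wj * (T ^ 2 - tj ^ 2)) * bj * (T - tj)) / (T - tj)) ^ 2) < ((W₀ * (T - t₀) ^ 2) + (Wi * (T - ti) ^ 2) + (Wk * (T - tk) ^ 2) + (Wj * (T - tj) ^ 2)) * (((-a) * W₀ * (T ^ 2 - t₀ ^ 2) + bi * Wi * (T ^ 2 - ti ^ 2) + bk * Wk * (T ^ 2 - tk ^ 2) + bj * Wj * (T ^ 2 - tj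 ^ 2)) * bk + ((((-a) ^ 2 * W₀ * (T - t₀) ^ 2 + bi ^ 2 * Wi * (T - ti) ^ 2 + bk ^ 2 * Wk * (T - tk) ^ 2 + bj ^ 2 * Wj * (T - tj) ^ 2) * (T + tk) - ((-a) * W₀ * (T ^ 2 - t₀ ^ 2) + bi * Wi * (T ^ 2 - ti ^ 2) + bk * Wk * (T ^ 2 - tk ^ 2) + bj * Wj * (T ^ 2 - tj ^ 2)) * bk * (T - tk)) / (T - tk))) ^ 2 := by
    rw [hQR, hM', egk]
    have hg2 : 1 < ((T + tk) / (T - tk)) ^ 2 := one_lt_pow₀ hgk1 two_ne_zero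
    have hposM : 0 < (W₀ * (T - t₀) ^ 2 + Wi * (T - ti) ^ 2 + Wk * (T - tk) ^ 2 + Wj * (T - tj) ^ 2) * (((-a) ^ 2 * W₀ * (T - t₀) ^ 2 + bi ^ 2 * Wi * (T - ti) ^ 2 + bk ^ 2 * Wk * (T - tk) ^ 2 + bj ^ 2 * Wj * (T - tj) ^ 2)) ^ 2 := mul_pos hMp (pow_pos hS2 2)
    have hlt := mul_lt_mul_of_pos_left hg2 hposM
    calc (W₀ * (T - t₀) ^ 2 + Wi * (T - ti) ^ 2 + Wk * (T - tk) ^ 2 + Wj * (T - tj) ^ 2) * (((-a) ^ 2 * W₀ * (T - t₀) ^ 2 + bi ^ 2 * Wi * (T - ti) ^ 2 + bk ^ 2 * Wk * (T - tk) ^ 2 + bj ^ 2 * Wj * (T - tj) ^ 2)) ^ 2 = (W₀ * (T - t₀) ^ 2 + Wi * (T - ti) ^ 2 + Wk * (T - tk) ^ 2 + Wj * (T - tj) ^ 2) * (((-a) ^ 2 * W₀ * (T - t₀) ^ 2 + bi ^ 2 * Wi * (T - ti) ^ 2 + bk ^ 2 * Wk * (T - tk) ^ 2 + bj ^ 2 *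 Wj * (T - tj) ^ 2)) ^ 2 * 1 := (mul_one _).symm
      _ < (W₀ * (T - t₀) ^ 2 + Wi * (T - ti) ^ 2 + Wk * (T - tk) ^ 2 + Wj * (T - tj) ^ 2) * (((-a) ^ 2 * W₀ * (T - t₀) ^ 2 + bi ^ 2 * Wi * (T - ti) ^ 2 + bk ^ 2 * Wk * (T - tk) ^ 2 + bj ^ 2 * Wj * (T - tj) ^ 2)) ^ 2 * ((T + tk) / (T - tk)) ^ 2 := hlt
      _ = (W₀ * (T - t₀) ^ 2 + Wi * (T - ti) ^ 2 + Wk * (T - tk) ^ 2 + Wj * (T - tj) ^ 2) * ((((-a) ^ 2 * W₀ * (T - t₀) ^ 2 + bi ^ 2 * Wi * (T - ti) ^ 2 + bk ^ 2 * Wk * (T - tk) ^ 2 + bj ^ 2 * Wj * (T - tj) ^ 2)) * ((T + tk) / (T - tk))) ^ 2 := by rw [mul_pow, mul_assoc]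
  -- signs of `U`
  have hU0 : 0 < ((-a) * W₀ * (T ^ 2 - t₀ ^ 2) + bi * Wi * (T ^ 2 - ti ^ 2) + bk * Wk * (T ^ 2 - tk ^ 2) + bj * Wj * (T ^ 2 - tj ^ 2)) * (-a) := mul_pos_of_neg_of_neg hSbg (by linarith)
  have hUi : ((-a) * W₀ * (T ^ 2 - t₀ ^ 2) + bi * Wi * (T ^ 2 - ti ^ 2) + bk * Wk * (T ^ 2 - tk ^ 2) + bj * Wj * (T ^ 2 - tj ^ 2)) * bi < 0 := mul_neg_of_neg_of_pos hSbg hbi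
  have hUk : ((-a) * W₀ * (T ^ 2 - t₀ ^ 2) + bi * Wi * (T ^ 2 - ti ^ 2) + bk * Wk * (T ^ 2 - tk ^ 2) + bj * Wj * (T ^ 2 - tj ^ 2)) * bk < 0 := mul_neg_of_neg_of_pos hSbg hbk
  have hji : ((-a) * W₀ * (T ^ 2 - t₀ ^ 2) + bi * Wi * (T ^ 2 - ti ^ 2) + bk * Wk * (T ^ 2 - tk ^ 2) + bj * Wj * (T ^ 2 - tj ^ 2)) * bj ≤ ((-a) * W₀ * (T ^ 2 - t₀ ^ 2) + bi * Wi * (T ^ 2 - ti ^ 2) + bk * Wk * (T ^ 2 - tk ^ 2) + bj * Wj * (T ^ 2 - tj ^ 2)) * bi := mul_le_mul_of_nonpos_left hij.le hSbg.le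
  have hjk : ((-a) * W₀ * (T ^ 2 - t₀ ^ 2) + bi * Wi * (T ^ 2 - ti ^ 2) + bk * Wk * (T ^ 2 - tk ^ 2) + bj * Wj * (T ^ 2 - tj ^ 2)) * bj ≤ ((-a) * W₀ * (T ^ 2 - t₀ ^ 2) + bi * Wi * (T ^ 2 - ti ^ 2) + bk * Wk * (T ^ 2 - tk ^ 2) + bj * Wj * (T ^ 2 - tj ^ 2)) * bk := mul_le_mul_of_nonpos_left hkj.le hSbg.le
  have hd0 : 0 < W₀ * (T - t₀) ^ 2 := mul_pos hW₀ (pow_pos u0 2)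
  have hdi : 0 < Wi * (T - ti) ^ 2 := mul_pos hWi (pow_pos ui 2)
  have hdk : 0 < Wk * (T - tk) ^ 2 := mul_pos hWk (pow_pos uk 2)
  have hdj : 0 < Wj * (T - tj) ^ 2 := mul_pos hWj htj2
  have main := cubicMoment_pos hd0 hdi hdk hdj hU0 hUi hUk hji hjk hEU hER hEUR hgi hgk hoi hok hgapi hgapk
  -- translate the conclusion
  rw [eUR20, eUR2i, eUR2k, eUR2j] at main
  have hfin := bridge_final W₀ Wi Wk Wj a bi bk bj t₀ ti tk tj T
  rw [hfin, h2] at main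
  rw [mul_zero, zero_mul, add_zero] at main
  have hpos : 0 < (-(((-a) * W₀ * (T ^ 2 - t₀ ^ 2) + bi * Wi * (T ^ 2 - ti ^ 2) + bk * Wk * (T ^ 2 - tk ^ 2) + bj * Wj * (T ^ 2 - tj ^ 2)))) * (4 * T ^ 2) := mul_pos (by linarith) (by positivity)
  by_contra hcon
  push Not at hcon
  exact absurd main (not_lt.mpr (mul_nonpos_iff.mpr (Or.inl ⟨hpos.le, hcon⟩)))


/-! ## 3. The unconditional lone-letter law for four letters -/

/-- **THE FASTEST-LONE-LETTER LAW (`K = 4`, right side): AT MOST TWO CRITICAL DIRECTIONS BEYOND THE PIVOT LETTER.**  Four letters (pivot at `t₀`,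
rate `−a`; `i, k` at `tᵢ, tₖ < t₀`, rates `bᵢ, bₖ`; `j` alone at `tⱼ > t₀` with the largest rate `bⱼ > bᵢ, bₖ`), exponents coupled as in the pencil
(`(a+bᵢ)(dₖ−d₀) = (a+bₖ)(dᵢ−d₀)`, `(a+bᵢ)(dⱼ−d₀) = (a+bⱼ)(dᵢ−d₀)`, `d₀ < dᵢ, dₖ`), ANY positive weights: there are no three critical points
`(x₁,T₁), (x₂,T₂), (x₃,T₃)` of the four-letter window profile with `t₀ < T₁ < T₂ < T₃`.  Equivalently the ψ-profile has at most two critical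
points, hence at most ONE local maximum, on the lone letter's side (memo MOMENT-FOLD.md). [folklore] -/
theorem lone_letter_four_right {a bi bk bj t₀ ti tk tj w₀ wi wk wj : ℝ} {d₀ di dk dj : ℕ}
    (ha : 0 < a) (hbi : 0 < bi) (hbk : 0 < bk) (hbj : 0 < bj) (hij : bi < bj) (hkj : bk < bj)
    (hti : 0 < ti) (htk : 0 < tk) (hi0 : ti < t₀) (hk0 : tk < t₀) (h0j : t₀ < tj)
    (hw₀ : 0 < w₀) (hwi : 0 < wi) (hwk : 0 < wk) (hwj : 0 < wj) (h0i : d₀ < di) (h0k : d₀ < dk)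
    (hci : (a + bi) * ((dk : ℝ) - d₀) = (a + bk) * ((di : ℝ) - d₀)) (hcj : (a + bi) * ((dj : ℝ) - d₀) = (a + bj) * ((di : ℝ) - d₀))
    {x₁ x₂ x₃ T₁ T₂ T₃ : ℝ} (hx₁ : 0 < x₁) (hx₂ : 0 < x₂) (hx₃ : 0 < x₃)
    (h01 : t₀ < T₁) (h12 : T₁ < T₂) (h23 : T₂ < T₃)
    (c₁ : w₀ * x₁ ^ d₀ * (T₁ ^ 2 - t₀ ^ 2) + wi * x₁ ^ di * (T₁ ^ 2 - ti ^ 2) + wk * x₁ ^ dk * (T₁ ^ 2 - tk ^ 2) + wj * x₁ ^ dj * (T₁ ^ 2 - tj ^ 2) = 0)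
    (c₁' : w₀ * x₁ ^ d₀ * (-a * (T₁ - t₀) ^ 2) + wi * x₁ ^ di * (bi * (T₁ - ti) ^ 2) + wk * x₁ ^ dk * (bk * (T₁ - tk) ^ 2) + wj * x₁ ^ dj * (bj * (T₁ - tj) ^ 2) = 0)
    (c₂ : w₀ * x₂ ^ d₀ * (T₂ ^ 2 - t₀ ^ 2) + wi * x₂ ^ di * (T₂ ^ 2 - ti ^ 2) + wk * x₂ ^ dk * (T₂ ^ 2 - tk ^ 2) + wj * x₂ ^ dj * (T₂ ^ 2 - tj ^ 2) = 0)
    (c₂' : w₀ * x₂ ^ d₀ * (-a * (T₂ - t₀) ^ 2) + wi * x₂ ^ di * (bi * (T₂ - ti) ^ 2) + wk * x₂ ^ dk * (bk * (T₂ - tk) ^ 2) + wj * x₂ ^ dj * (bj * (T₂ - tj) ^ 2) = 0)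
    (c₃ : w₀ * x₃ ^ d₀ * (T₃ ^ 2 - t₀ ^ 2) + wi * x₃ ^ di * (T₃ ^ 2 - ti ^ 2) + wk * x₃ ^ dk * (T₃ ^ 2 - tk ^ 2) + wj * x₃ ^ dj * (T₃ ^ 2 - tj ^ 2) = 0)
    (c₃' : w₀ * x₃ ^ d₀ * (-a * (T₃ - t₀) ^ 2) + wi * x₃ ^ di * (bi * (T₃ - ti) ^ 2) + wk * x₃ ^ dk * (bk * (T₃ - tk) ^ 2) + wj * x₃ ^ dj * (bj * (T₃ - tj) ^ 2) = 0) :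
    False := by
  refine lone_letter_four_right_of_foldCubic_pos ha hbi hbk hbj hij hkj hti htk hi0 hk0 h0j hw₀ hwi hwk hwj h0i h0k hci hcj ?_
    hx₁ hx₂ hx₃ h01 h12 h23 c₁ c₁' c₂ c₂' c₃ c₃'
  intro T x O h0T hTj hx hO e1 e2 efold
  exact foldCubic_pos (W₀ := w₀ * x ^ d₀) (Wi := wi * x ^ di) (Wk := wk * x ^ dk) (Wj := O * x ^ dj)
    (mul_pos hw₀ (pow_pos hx d₀)) (mul_pos hwi (pow_pos hx di)) (mul_pos hwk (pow_pos hx dk)) (mul_pos hO (pow_pos hx dj))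
    ha hbi hbk hbj hij hkj hti htk hi0 hk0 h0T hTj e1 e2 efold

end Summit.ValiantsHypothesis.ValiantsHypothesis.Theorems.LacunarySymmetroidMatrixDescartes.Pivot.CriticalWindows.Four
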